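import Literature.Computability.Cryptography.HallgrenClassGroupIdealEnumeration
import HarnessLib

/-!
# Hallgren 2005 / class groups — enumerating the ideals of a given norm by reduced forms, II:
# the product over the primes and the dictionary

Topic `Literature/Computability/Cryptography`; continuation of
`HallgrenClassGroupIdealEnumeration.lean` (the local data `localCount`, `localForm`, `localIdeal`
at one prime). For `a = ∏ p^e` (`factorPairs a`) the `k`-th ideal of norm `a` is the product of
the local ideals selected by the mixed-radix digits of `k` (`idealOf`), its reduced form is the
composition of the local forms (`enumForm`), and there are `enumCount = ∏ localCount` of them
(Cohen, *A Course in Computational Algebraic Number Theory*, §4.6: coprime splitting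
`I = (I + (u))(I + (v))`, `eq_mul_of_absNorm_eq_mul`; §5.2): `absNorm_idealOf`, `idealOf_injective`,
`exists_eq_idealOf`, `mk0_idealOf` (`k ↦ idealOf F k` is a bijection from `[0, enumCount F)` onto
the ideals of norm `∏ p^e`, `[idealOf F k] = classOf (enumForm F k)`, `enumForm F k` reduced), and
**the dictionary** `ncard_absNorm_eq_eq_card_filter`: for `a ≠ 0` and any property `P` of classes,
`#{𝔞 : N𝔞 = a, P[𝔞]} = #{k < enumCount : P (classOf (enumForm k))}`; `card_absNorm_eq`:
`r_K(a) = enumCount (factorPairs a)`.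

## References

* H. Cohen, *A Course in Computational Algebraic Number Theory*, GTM 138 (1993), §4.6, §5.2 [Cohen1993].
* D. A. Cox, *Primes of the form x² + ny²*, 2nd ed. (2013), §7.B Thm. 7.7 [Cox2013].
-/

noncomputable section

open scoped nonZeroDivisors

namespace Literature.Computability.Cryptography.Hallgren2005

namespace FormComposition

open Module NumberField Ideal
open Literature.NumberTheory.QuadraticFields.Quadratic Literature.NumberTheory.QuadraticFields.Quadratic.BinQF
open Literature.NumberTheory.EllipticCurves Composition Reduction

/-! ### Field-free enumeration data for a factored norm -/

/-- The number of ideals of norm `∏ p^e` (over a list of prime powers): the product of the local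
counts. [cite: Cohen1993, §5.2] -/
def enumCount (D : ℤ) : List (ℕ × ℕ) → ℕ
  | [] => 1
  | pe :: F => localCount D pe.1 pe.2 * enumCount D F

/-- The reduced form of the `k`-th ideal of norm `∏ p^e` (the mixed-radix digits of `k` select the
local factors, which are composed). [cite: Cohen1993, §5.2] -/
def enumForm (D : ℤ) : List (ℕ × ℕ) → ℕ → BinQF
  | [], _ => one D
  | pe :: F, k => compose D (localForm D pe.1 pe.2 (k % localCount D pe.1 pe.2))
      (enumForm D F (k / localCount D pe.1 pe.2))

/-- The prime-power list `[(p, v_p(a))]` of `a`, primes in increasing order. [folklore] -/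
def factorPairs (a : ℕ) : List (ℕ × ℕ) :=
  (a.primeFactors.sort (· ≤ ·)).map fun p => (p, a.factorization p)

/-- `∏ p^e` over a prime-power list. [folklore] -/
def pairsProd (F : List (ℕ × ℕ)) : ℕ := (F.map fun pe => pe.1 ^ pe.2).prod

/-- The entries of `factorPairs a` are primes (with their exponents). [folklore] -/
theorem prime_of_mem_factorPairs {a : ℕ} {pe : ℕ × ℕ} (h : pe ∈ factorPairs a) : pe.1.Prime := by
  unfold factorPairs at h
  obtain ⟨p, hp, rfl⟩ := List.mem_map.1 h
  exact Nat.prime_of_mem_primeFactors ((Finset.mem_sort _).1 hp)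

/-- The primes of `factorPairs a` are distinct. [folklore] -/
theorem nodup_factorPairs (a : ℕ) : ((factorPairs a).map Prod.fst).Nodup := by
  rw [factorPairs, List.map_map, show (Prod.fst ∘ fun p => (p, a.factorization p)) = id from rfl,
    List.map_id]
  exact Finset.sort_nodup a.primeFactors (· ≤ ·)

/-- `∏ p^{v_p(a)} = a` for `a ≠ 0`. [folklore] -/
theorem pairsProd_factorPairs {a : ℕ} (ha : a ≠ 0) : pairsProd (factorPairs a) = a := by
  classical
  simp only [pairsProd, factorPairs, List.map_map]
  have h := List.prod_toFinset (fun p => p ^ a.factorization p)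
    (l := a.primeFactors.sort (· ≤ ·)) (Finset.sort_nodup _ _)
  rw [Finset.sort_toFinset, ← Nat.support_factorization] at h
  exact h ▸ Nat.prod_factorization_pow_eq_self ha

/-- `pairsProd ((p, e) :: F) = p^e · pairsProd F`. [folklore] -/
theorem pairsProd_cons (pe : ℕ × ℕ) (F : List (ℕ × ℕ)) :
    pairsProd (pe :: F) = pe.1 ^ pe.2 * pairsProd F := by simp [pairsProd]

/-- `p^e` is coprime to `pairsProd F` when `p` is a prime not among the primes of `F`. [folklore] -/
theorem coprime_pow_pairsProd {p e : ℕ} (hp : p.Prime) {F : List (ℕ × ℕ)}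
    (hF : ∀ pe ∈ F, pe.1.Prime) (hpF : p ∉ F.map Prod.fst) : (p ^ e).Coprime (pairsProd F) := by
  refine Nat.Coprime.pow_left _ ?_
  rw [pairsProd, Nat.coprime_list_prod_right_iff]
  intro n hn
  obtain ⟨qe, hqe, rfl⟩ := List.mem_map.1 hn
  refine Nat.Coprime.pow_right _ ((Nat.coprime_primes hp (hF qe hqe)).2 ?_)
  rintro h
  exact hpF (List.mem_map.2 ⟨qe, hqe, h.symm⟩)

/-- `pairsProd F ≠ 0` for a list of primes. [folklore] -/
theorem pairsProd_ne_zero {F : List (ℕ × ℕ)} (hF : ∀ pe ∈ F, pe.1.Prime) : pairsProd F ≠ 0 :=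
  List.prod_ne_zero fun h => by
    obtain ⟨qe, hqe, h0⟩ := List.mem_map.1 h
    exact pow_ne_zero _ (hF qe hqe).ne_zero h0

/-! ### Coprime splitting of ideals -/

section Split

variable {K : Type*} [Field K] [NumberField K]

omit [NumberField K] in
/-- `(u) ⊔ (v) = ⊤` for coprime naturals. [folklore] -/
theorem span_natCast_sup_span_natCast_eq_top {u v : ℕ} (huv : u.Coprime v) :
    span {(u : 𝓞 K)} ⊔ span {(v : 𝓞 K)} = ⊤ := by
  rw [eq_top_iff_one, Submodule.mem_sup]
  have h := Nat.gcd_eq_gcd_ab u v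
  rw [Nat.Coprime.gcd_eq_one huv] at h
  refine ⟨(u : 𝓞 K) * (u.gcdA v : 𝓞 K), mem_span_singleton'.2 ⟨(u.gcdA v : 𝓞 K), by ring⟩,
    (v : 𝓞 K) * (u.gcdB v : 𝓞 K), mem_span_singleton'.2 ⟨(u.gcdB v : 𝓞 K), by ring⟩, ?_⟩
  have := congrArg (Int.cast : ℤ → 𝓞 K) h
  push_cast at this
  exact this.symm

/-- An ideal whose norm divides two coprime naturals is `⊤`. [folklore] -/
theorem eq_top_of_absNorm_dvd_coprime {J : Ideal (𝓞 K)} {u v : ℕ} (huv : u.Coprime v)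
    (hu : absNorm J ∣ u) (hv : absNorm J ∣ v) : J = ⊤ :=
  absNorm_eq_one_iff.1 (Nat.eq_one_of_dvd_coprimes huv hu hv)

/-- **Coprime splitting**: an ideal of norm `uv`, `gcd(u, v) = 1`, `u, v ≠ 0`, is
`(I + (u)) · (I + (v))`, with factors of norms `u` and `v`. [cite: Cohen1993, §4.6] -/
theorem eq_mul_of_absNorm_eq_mul {I : Ideal (𝓞 K)} {u v : ℕ} (hI : absNorm I = u * v)
    (huv : u.Coprime v) (hu : u ≠ 0) (hv : v ≠ 0) :
    I = (I ⊔ span {(u : 𝓞 K)}) * (I ⊔ span {(v : 𝓞 K)}) ∧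
      absNorm (I ⊔ span {(u : 𝓞 K)}) = u ∧ absNorm (I ⊔ span {(v : 𝓞 K)}) = v := by
  set I₁ := I ⊔ span {(u : 𝓞 K)}
  set I₂ := I ⊔ span {(v : 𝓞 K)}
  have hprod : I = I₁ * I₂ := by
    refine le_antisymm ?_ ?_
    · have htop := span_natCast_sup_span_natCast_eq_top (K := K) huv
      calc I = I * ⊤ := (Ideal.mul_top I).symm
        _ = I * span {(u : 𝓞 K)} ⊔ I * span {(v : 𝓞 K)} := by rw [← htop, Ideal.mul_sup]
        _ ≤ I₁ * I₂ := sup_le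
            (by rw [mul_comm]; exact Ideal.mul_mono le_sup_right le_sup_left)
            (Ideal.mul_mono le_sup_left le_sup_right)
    · rw [Ideal.mul_le]
      intro r hr s hs
      obtain ⟨i₁, hi₁, x, hx, rfl⟩ := Submodule.mem_sup.1 hr
      obtain ⟨i₂, hi₂, y, hy, rfl⟩ := Submodule.mem_sup.1 hs
      obtain ⟨x, rfl⟩ := mem_span_singleton'.1 hx
      obtain ⟨y, rfl⟩ := mem_span_singleton'.1 hy
      have hmem : ((u * v : ℕ) : 𝓞 K) ∈ I := hI ▸ absNorm_mem I
      have : (i₁ + x * (u : 𝓞 K)) * (i₂ + y * (v : 𝓞 K)) =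
          i₁ * (i₂ + y * (v : 𝓞 K)) + x * (u : 𝓞 K) * i₂ + (x * y) * ((u * v : ℕ) : 𝓞 K) := by
        push_cast; ring
      rw [this]
      exact I.add_mem (I.add_mem (I.mul_mem_right _ hi₁) (I.mul_mem_left _ hi₂))
        (I.mul_mem_left _ hmem)
  have hN : absNorm I₁ * absNorm I₂ = u * v := by rw [← map_mul, ← hprod, hI]
  have hc₁ : (absNorm I₁).Coprime v := by
    have h := absNorm_dvd_absNorm_of_le (le_sup_right : span {(u : 𝓞 K)} ≤ I₁)
    rw [absNorm_span_natCast] at h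
    exact Nat.Coprime.coprime_dvd_left h (huv.pow_left _)
  have hc₂ : (absNorm I₂).Coprime u := by
    have h := absNorm_dvd_absNorm_of_le (le_sup_right : span {(v : 𝓞 K)} ≤ I₂)
    rw [absNorm_span_natCast] at h
    exact Nat.Coprime.coprime_dvd_left h (huv.symm.pow_left _)
  have hd₁ : absNorm I₁ ∣ u := hc₁.dvd_of_dvd_mul_right ⟨absNorm I₂, hN.symm⟩
  have hd₂ : absNorm I₂ ∣ v := hc₂.dvd_of_dvd_mul_left ⟨absNorm I₁, by rw [← hN, mul_comm]⟩
  obtain ⟨x, hx⟩ := hd₁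
  obtain ⟨y, hy⟩ := hd₂
  have hxy : x * y = 1 := by
    have h0 : 0 < absNorm I₁ * absNorm I₂ := by rw [hN]; positivity
    refine Nat.eq_of_mul_eq_mul_left h0 ?_
    rw [mul_one]; nth_rw 2 [hN]; rw [hx, hy]; ring
  rw [Nat.eq_one_of_mul_eq_one_right hxy, mul_one] at hx
  rw [Nat.eq_one_of_mul_eq_one_left hxy, mul_one] at hy
  exact ⟨hprod, hx.symm, hy.symm⟩

/-- **Recovering the factors**: `I₁ I₂ + (u) = I₁` for `N I₁ = u`, `N I₂ = v`, `gcd(u, v) = 1`.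
[cite: Cohen1993, §4.6] -/
theorem mul_sup_span_eq_left {I₁ I₂ : Ideal (𝓞 K)} {u v : ℕ} (h₁ : absNorm I₁ = u)
    (h₂ : absNorm I₂ = v) (huv : u.Coprime v) : I₁ * I₂ ⊔ span {(u : 𝓞 K)} = I₁ := by
  refine le_antisymm (sup_le Ideal.mul_le_right ?_) ?_
  · rw [span_singleton_le_iff_mem, ← h₁]; exact absNorm_mem I₁
  · have htop : I₂ ⊔ span {(u : 𝓞 K)} = ⊤ := by
      refine eq_top_of_absNorm_dvd_coprime (u := v) (v := u ^ finrank ℤ (𝓞 K))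
        (huv.symm.pow_right _) (h₂ ▸ absNorm_dvd_absNorm_of_le le_sup_left) ?_
      have := absNorm_dvd_absNorm_of_le (le_sup_right : span {(u : 𝓞 K)} ≤ I₂ ⊔ span {(u : 𝓞 K)})
      rwa [absNorm_span_natCast] at this
    calc I₁ = I₁ * ⊤ := (Ideal.mul_top _).symm
      _ = I₁ * I₂ ⊔ I₁ * span {(u : 𝓞 K)} := by rw [← htop, Ideal.mul_sup]
      _ ≤ I₁ * I₂ ⊔ span {(u : 𝓞 K)} := sup_le_sup_left Ideal.mul_le_left _

/-- `I₁ I₂ + (v) = I₂` likewise. [cite: Cohen1993, §4.6] -/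
theorem mul_sup_span_eq_right {I₁ I₂ : Ideal (𝓞 K)} {u v : ℕ} (h₁ : absNorm I₁ = u)
    (h₂ : absNorm I₂ = v) (huv : u.Coprime v) : I₁ * I₂ ⊔ span {(v : 𝓞 K)} = I₂ :=
  mul_comm I₁ I₂ ▸ mul_sup_span_eq_left h₂ h₁ huv.symm

end Split

/-! ### The global dictionary -/

section Ring

variable {K : Type*} [Field K] [NumberField K] (b : Basis (Fin 2) ℤ (𝓞 K)) (hb : b 0 = 1)
  (hω : b 1 * b 1 = (mOf (NumberField.discr K) : 𝓞 K) + (NumberField.discr K : 𝓞 K) * b 1)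

/-- The `k`-th ideal of norm `∏ p^e`: the product of the local ideals selected by the mixed-radix
digits of `k`. [cite: Cohen1993, §5.2] -/
def idealOf : List (ℕ × ℕ) → ℕ → Ideal (𝓞 K)
  | [], _ => ⊤
  | pe :: F, k => localIdeal b pe.1 pe.2 (k % localCount (NumberField.discr K) pe.1 pe.2) *
      idealOf F (k / localCount (NumberField.discr K) pe.1 pe.2)

include hb in
/-- `idealOf F k` is a non-zero ideal. [folklore] -/
theorem idealOf_mem_nonZeroDivisors {F : List (ℕ × ℕ)} (hF : ∀ pe ∈ F, pe.1.Prime) (k : ℕ) :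
    idealOf b F k ∈ (Ideal (𝓞 K))⁰ := by
  induction F generalizing k with
  | nil => rw [idealOf, ← Ideal.one_eq_top]; exact one_mem _
  | cons pe F ih =>
    exact mul_mem (localIdeal_mem_nonZeroDivisors b hb (hF pe (by simp)) _ _)
      (ih (fun qe hqe => hF qe (by simp [hqe])) _)

/-- The mixed-radix digits of `k < ℓ n` are `< ℓ` and `< n`. [folklore] -/
theorem digits_lt {ℓ n k : ℕ} (hk : k < ℓ * n) : k % ℓ < ℓ ∧ k / ℓ < n :=
  have hℓ : 0 < ℓ := Nat.pos_of_mul_pos_right ((Nat.zero_le k).trans_lt hk)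
  ⟨Nat.mod_lt _ hℓ, (Nat.div_lt_iff_lt_mul hℓ).2 (by rwa [mul_comm] at hk)⟩

include hb hω in
/-- **Norm**: `N(idealOf F k) = ∏ p^e` for `k < enumCount`. [cite: Cohen1993, §5.2] -/
theorem absNorm_idealOf (hK : IsImaginaryQuadratic K) {F : List (ℕ × ℕ)}
    (hF : ∀ pe ∈ F, pe.1.Prime) {k : ℕ} (hk : k < enumCount (NumberField.discr K) F) :
    absNorm (idealOf b F k) = pairsProd F := by
  induction F generalizing k with
  | nil => simp [idealOf, pairsProd]
  | cons pe F ih =>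
    obtain ⟨h1, h2⟩ := digits_lt (hk : k < localCount _ pe.1 pe.2 * enumCount _ F)
    rw [idealOf, map_mul, absNorm_localIdeal b hb hω hK (hF pe (by simp)) h1,
      ih (fun qe hqe => hF qe (by simp [hqe])) h2, pairsProd_cons]

include hb hω in
/-- **Distinctness**: `idealOf F k = idealOf F k'` with `k, k' < enumCount` forces `k = k'`
(coprime splitting recovers the local factors; local distinctness; induction).
[cite: Cohen1993, §5.2] -/
theorem idealOf_injective (hK : IsImaginaryQuadratic K) {F : List (ℕ × ℕ)}
    (hF : ∀ pe ∈ F, pe.1.Prime) (hnd : (F.map Prod.fst).Nodup) {k k' : ℕ}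
    (hk : k < enumCount (NumberField.discr K) F) (hk' : k' < enumCount (NumberField.discr K) F)
    (h : idealOf b F k = idealOf b F k') : k = k' := by
  induction F generalizing k k' with
  | nil =>
    simp only [enumCount] at hk hk'
    omega
  | cons pe F ih =>
    obtain ⟨p, e⟩ := pe
    have hp : p.Prime := hF (p, e) (by simp)
    have hF' : ∀ qe ∈ F, qe.1.Prime := fun qe hqe => hF qe (by simp [hqe])
    obtain ⟨hpF, hnd'⟩ := List.nodup_cons.1 ((List.map_cons ..) ▸ hnd)
    have hcop : (p ^ e).Coprime (pairsProd F) := coprime_pow_pairsProd hp hF' hpF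
    obtain ⟨h1, h2⟩ := digits_lt (hk : k < localCount _ p e * enumCount _ F)
    obtain ⟨h1', h2'⟩ := digits_lt (hk' : k' < localCount _ p e * enumCount _ F)
    have n₁ := absNorm_localIdeal b hb hω hK hp h1
    have n₁' := absNorm_localIdeal b hb hω hK hp h1'
    have n₂ := absNorm_idealOf b hb hω hK hF' h2
    have n₂' := absNorm_idealOf b hb hω hK hF' h2'
    change localIdeal b p e _ * idealOf b F _ = localIdeal b p e _ * idealOf b F _ at h
    have e₁ := mul_sup_span_eq_left n₁ n₂ hcop
    rw [h, mul_sup_span_eq_left n₁' n₂' hcop] at e₁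
    have e₂ := mul_sup_span_eq_right n₁ n₂ hcop
    rw [h, mul_sup_span_eq_right n₁' n₂' hcop] at e₂
    have d₁ := localIdeal_injective b hb hω hK hp h1 h1' e₁.symm
    have d₂ := ih hF' hnd' h2 h2' e₂.symm
    rw [← Nat.div_add_mod k (localCount (NumberField.discr K) p e),
      ← Nat.div_add_mod k' (localCount (NumberField.discr K) p e), d₁, d₂]

include hb hω in
/-- **Exhaustion**: every ideal of norm `∏ p^e` is `idealOf F k` for some `k < enumCount`.
[cite: Cohen1993, §5.2] -/
theorem exists_eq_idealOf (hK : IsImaginaryQuadratic K) {F : List (ℕ × ℕ)}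
    (hF : ∀ pe ∈ F, pe.1.Prime) (hnd : (F.map Prod.fst).Nodup) {I : Ideal (𝓞 K)}
    (hI : absNorm I = pairsProd F) :
    ∃ k, k < enumCount (NumberField.discr K) F ∧ I = idealOf b F k := by
  induction F generalizing I with
  | nil =>
    refine ⟨0, Nat.one_pos, ?_⟩
    rw [idealOf, ← absNorm_eq_one_iff, hI]
    rfl
  | cons pe F ih =>
    obtain ⟨p, e⟩ := pe
    have hp : p.Prime := hF (p, e) (by simp)
    have hF' : ∀ qe ∈ F, qe.1.Prime := fun qe hqe => hF qe (by simp [hqe])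
    obtain ⟨hpF, hnd'⟩ := List.nodup_cons.1 ((List.map_cons ..) ▸ hnd)
    have hcop : (p ^ e).Coprime (pairsProd F) := coprime_pow_pairsProd hp hF' hpF
    rw [pairsProd_cons] at hI
    obtain ⟨hIeq, n₁, n₂⟩ := eq_mul_of_absNorm_eq_mul hI hcop (pow_ne_zero _ hp.ne_zero)
      (pairsProd_ne_zero hF')
    obtain ⟨j, hj, hj'⟩ := exists_eq_localIdeal b hb hω hK hp n₁
    obtain ⟨k', hk', hk''⟩ := ih hF' hnd' n₂
    set ℓ := localCount (NumberField.discr K) p e with hℓ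
    have hℓ0 : 0 < ℓ := by omega
    refine ⟨j + ℓ * k', ?_, ?_⟩
    · calc j + ℓ * k' < ℓ + ℓ * k' := by omega
        _ = ℓ * (k' + 1) := by ring
        _ ≤ ℓ * enumCount (NumberField.discr K) F := Nat.mul_le_mul_left _ hk'
    · change I = localIdeal b p e ((j + ℓ * k') % ℓ) * idealOf b F ((j + ℓ * k') / ℓ)
      rw [Nat.add_mul_mod_self_left, Nat.mod_eq_of_lt hj, Nat.add_mul_div_left _ _ hℓ0,
        Nat.div_eq_of_lt hj, zero_add, ← hj', ← hk'']
      exact hIeq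

include hω in
/-- **Classes**: `[idealOf F k] = classOf (enumForm F k)`, and `enumForm F k` is a reduced primitive
positive definite form of discriminant `d_K`. [cite: Cox2013, §7.B Thm. 7.7] -/
theorem mk0_idealOf (hK : IsImaginaryQuadratic K) {F : List (ℕ × ℕ)}
    (hF : ∀ pe ∈ F, pe.1.Prime) (k : ℕ) :
    (enumForm (NumberField.discr K) F k).IsPosPrim (NumberField.discr K) ∧
      (enumForm (NumberField.discr K) F k).IsReduced ∧
      ClassGroup.mk0 ⟨idealOf b F k, idealOf_mem_nonZeroDivisors b hb hF k⟩ =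
        classOf b hb (enumForm (NumberField.discr K) F k) := by
  induction F generalizing k with
  | nil =>
    obtain ⟨h1, h2⟩ := isPosPrim_one hK.discr_neg (discr_emod_four hK.finrank_eq_two)
    refine ⟨h1, h2, ?_⟩
    rw [enumForm, classOf_one' b hb, ← map_one ClassGroup.mk0]
    congr 1
    apply Subtype.ext
    show idealOf b [] k = ((1 : (Ideal (𝓞 K))⁰) : Ideal (𝓞 K))
    rw [OneMemClass.coe_one, Ideal.one_eq_top]
    rfl
  | cons pe F ih =>
    have hp : pe.1.Prime := hF pe (by simp)
    have hF' : ∀ qe ∈ F, qe.1.Prime := fun qe hqe => hF qe (by simp [hqe])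
    obtain ⟨hp1, -, hc1⟩ := mk0_localIdeal b hb hω hK hp pe.2
      (k % localCount (NumberField.discr K) pe.1 pe.2)
    obtain ⟨hp2, -, hc2⟩ := ih hF' (k / localCount (NumberField.discr K) pe.1 pe.2)
    refine ⟨isPosPrim_compose b hb hω hK hp1 hp2, isReduced_compose b hb hω hK hp1 hp2, ?_⟩
    rw [enumForm, classOf_compose b hb hω hK hp1 hp2, ← hc1, ← hc2, ← map_mul]
    congr 1

open Classical in
include hb hω in
/-- **The dictionary**: for `a ≠ 0` and any property `P` of ideal classes, the ideals of norm `a`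
whose class has `P` are equinumerous with the indices `k < enumCount (factorPairs a)` whose form
`enumForm k` has a class with `P`. [cite: Cohen1993, §5.2] -/
theorem ncard_absNorm_eq_eq_card_filter (hK : IsImaginaryQuadratic K) (P : ClassGroup (𝓞 K) → Prop)
    {a : ℕ} (ha : a ≠ 0) :
    Set.ncard {I : Ideal (𝓞 K) | absNorm I = a ∧
        ∃ h0 : I ∈ (Ideal (𝓞 K))⁰, P (ClassGroup.mk0 ⟨I, h0⟩)} =
      ((Finset.range (enumCount (NumberField.discr K) (factorPairs a))).filter
        (fun k => P (classOf b hb (enumForm (NumberField.discr K) (factorPairs a) k)))).card := by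
  classical
  have hF : ∀ pe ∈ factorPairs a, pe.1.Prime := fun pe h => prime_of_mem_factorPairs h
  have hnd := nodup_factorPairs a
  have hprod := pairsProd_factorPairs ha
  set T : Finset ℕ := (Finset.range (enumCount (NumberField.discr K) (factorPairs a))).filter
    (fun k => P (classOf b hb (enumForm (NumberField.discr K) (factorPairs a) k))) with hT
  have himage : {I : Ideal (𝓞 K) | absNorm I = a ∧
      ∃ h0 : I ∈ (Ideal (𝓞 K))⁰, P (ClassGroup.mk0 ⟨I, h0⟩)} =
      (fun k => idealOf b (factorPairs a) k) '' (T : Set ℕ) := by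
    ext I
    simp only [Set.mem_setOf_eq, Set.mem_image, hT, Finset.coe_filter, Finset.mem_range]
    constructor
    · rintro ⟨hIa, h0, hP⟩
      obtain ⟨k, hk, rfl⟩ := exists_eq_idealOf b hb hω hK hF hnd (hIa.trans hprod.symm)
      refine ⟨k, ⟨hk, ?_⟩, rfl⟩
      rw [← (mk0_idealOf b hb hω hK hF k).2.2]
      exact hP
    · rintro ⟨k, ⟨hk, hP⟩, rfl⟩
      refine ⟨(absNorm_idealOf b hb hω hK hF hk).trans hprod,
        idealOf_mem_nonZeroDivisors b hb hF k, ?_⟩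
      rw [(mk0_idealOf b hb hω hK hF k).2.2]
      exact hP
  have hinj : Set.InjOn (fun k => idealOf b (factorPairs a) k) (T : Set ℕ) := by
    rintro k hk k' hk' h
    simp only [hT, Finset.coe_filter, Finset.mem_range, Set.mem_setOf_eq] at hk hk'
    exact idealOf_injective b hb hω hK hF hnd hk.1 hk'.1 h
  rw [himage, hinj.ncard_image, Set.ncard_coe_finset]

open Classical in
include hb hω in
/-- **The number of ideals of norm `a`** is `enumCount (factorPairs a)` (`a ≠ 0`).
[cite: Cohen1993, §5.2] -/
theorem card_absNorm_eq (hK : IsImaginaryQuadratic K) {a : ℕ} (ha : a ≠ 0) :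
    Nat.card {I : Ideal (𝓞 K) // absNorm I = a} = enumCount (NumberField.discr K) (factorPairs a) := by
  classical
  have h := ncard_absNorm_eq_eq_card_filter b hb hω hK (fun _ => True) ha
  simp only [Finset.filter_true, Finset.card_range] at h
  rw [← h, ← Nat.card_coe_set_eq]
  congr 2
  ext I
  simp only [Set.mem_setOf_eq]
  constructor
  · intro hI
    exact ⟨hI, absNorm_ne_zero_iff_mem_nonZeroDivisors.1 (hI ▸ ha), trivial⟩
  · exact fun h => h.1

end Ring

end FormComposition

end Literature.Computability.Cryptography.Hallgren2005

end
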